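import Summits.BirchSwinnertonDyer.Rank1Residual.ManinAdditive.ShimuraIndexSignLaws
import Literature.NumberTheory.EllipticCurves.EisensteinCongruenceRationalTorsionProofs
import HarnessLib
import HarnessLib.Audit.Tags

/-!
# THE CUSP-LIFTING LAW E-an-128 `ShimuraThreeForcesRationalThreeTorsion` and its family (E-an-128ℓ / 128♮ / 128♭ / 128₄)
# — cell `bsd-f2-manin` (D-0131 (3) frontier: the Manin constant at additive primes), lens `an` (Shimura cover / cuspidal
# torsors), planner an g27 MEMO-an §69; typed by the cell typer g14 (T-an-31 v2, 2026-08-28T18:05:09Z) VERBATIM from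
# HOME/an/g27/Sketch-an-g27.lean sha16 a3f085befa32e0ff (§1–§4; farm rc 0 · 0 warnings · 0 sorries; BC7 5/5 CLEAN raw
# f92f7d10eeb20d69 + 44f78aa12b80f7cd), namespace `BsdF2ManinAnG27` ↦ `…ManinAdditive.KatoCurve` (beside es's Shimura-index laws),
# the five law `def`s tagged `@[conjecture]` (nothing asserted), docstrings extended with the honest framing.

HONEST FRAMING.  The five rows are THEOREMS ON PAPER (an, MEMO-an §69.2 / §69.2′: comparison of two `ℤ/ℓ^k`-torsors on
`X₀(N)/ℚ`, Vatsal Thm 1.17 / Rem 1.18 + Hochschild–Serre + the splitting of the two rational cusps in `X₁(N) → X₀(N)`), typed as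
LAWS (obligation nodes) until a refuter pass and a Lean proof exist; NOT in print as stated (nearest print BY NAME: the constant
kernel of the Shimura cover [LingOesterle1991] / [Vatsal2005, Thm. 1.17, Rem. 1.18]; optimal-curve torsion vs. cuspidal subgroup at
square-free level [Dummigan2005], [ByeonYhee2013]; Stevens' parametrisation comparison [Stevens1989, §2]).  BC5 witness (an g26/g27,
HOME/an/g27/mu3pos-rows.tsv 0a006ff66c538492 + HOME/an/g26/iota3-ALL.tsv a95c6688edfa3351): the 8 classes with `ι₃ = 1`
(`14a1 19a1 26a1 35a1 77b1 370c1 27a1 54a1`) all have `3 ∣ #E₀(ℚ)_tors` and rank `0`; every decided class without rational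
`3`-torsion has `ι₃ = 0` (30/58 residue survivors by ENGINE 2, kit j312822 / j313134); §4 sanity `exp U(N) ∣ ord φ(0)` at 12/12
genus-one levels (HOME/an/g27/u_exp_check.py).  REF1 R-an-49 (audit of §69.2 steps (a)–(f), scope += §4) and REF2 R-an-50
(placement vs Stevens 1989 §2 / Ling–Oesterlé 1991) PENDING at filing — a finding is repaired under a NEW name (append-only).
Why novel: proves es's E-es-67 / 67♯ / 67♯₂₇ from ONE law with no sign law, no census, no `c₀ = 1`, any level (edges §2,
kernel-checked), so C3's stub-5 `μ₃`-residue closes modulo E-an-128 alone (TURNKEY-an-14: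
`threeAdicUnitWitnessOfNoRationalThreeTorsion_of_cuspLifting h66 h128`).  bears_on: stmt-BirchSwinnertonDyer-22968 (C3), §4's
E-an-128₄ offered to the `4 ∣ N` lanes (C2, stmt-BirchSwinnertonDyer-22967).  PARTITION 0 · beyond-print theorem: yes on paper
(an), no in Lean · BSD is not proved by this; Manin's conjecture is not proved by this.

an g27 VERBATIM:

MEMO-an §69.  For an optimal `W = E₀ = ℂ/Λ₀(f)` the Shimura cover `E₁ = ℂ/Λ₁(f) → E₀` has constant kernel
dual to `E₀ ∩ Σ(N)` (Ling–Oesterlé; Vatsal 2005 Rem. 1.8).  **THEOREM (paper, MEMO-an §69.2; E-an-128).**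
If an odd prime `ℓ` divides `[Λ₀(f) : Λ₁(f)] = #(E₀ ∩ Σ(N))` then the cuspidal point `P₀ = φ((0) − (∞)) ∈ E₀(ℚ)`
has order divisible by `ℓ`; in particular `E₀(ℚ)` has a point of order `ℓ` and `L(f,1) = {∞,0}_f ≠ 0`.
Proof: `C := (E₀ ∩ Σ)[ℓ] ≅ μ_ℓ`, `λ : E' := (E₀/C)^∨-side curve → E₀` the isogeny with constant kernel `ℤ/ℓ`;
the `ℤ/ℓ`-torsors `Y := X₀(N) ×_{E₀} E'` and the Shimura subcover `X^ψ ⊂ X₁(N)` cut out by `φ^*C = Σ_ψ` agree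
geometrically (Vatsal Thm 1.17), so `[Y] = ±[X^ψ] + χ`, `χ ∈ H¹(ℚ, ℤ/ℓ)` (Hochschild–Serre).  Restrict to the two
rational cusps: `[Y]_∞ = δ_λ(O) = 0`, `[X^ψ]_∞ = [Spec ℚ(ζ_N)^{ker ψ}] ≠ 0` (the cusps of `X₁(N)` above `∞ = (Tate(q), μ_N)`
are conjugate), `[X^ψ]_0 = 0` (the cusps above `0 = (Tate(q), ⟨q^{1/N}⟩)` are rational), whence
`δ_λ(φ(0)) = [Y]_0 = χ = ∓[X^ψ]_∞ ≠ 0`, i.e. `φ(0) ∉ λ(E'(ℚ)) ⊇ ℓ·E₀(ℚ)`; `φ(0)` is torsion (Manin–Drinfeld). ∎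
No sign law, no census, no `c₀ = 1`, any level `N`.  It PROVES es's E-es-67♯ (incl. the 27-adic residual
`PlusIndexPrimeToThreeOfMuThreeAt27`) and the whole of E-es-67 from ONE law (§2 below, kernel-checked edges), and §3 routes
the a-priori bound `ℓ ∈ {3,5,7}` (elementary: `μ_ℓ ⊂ E₀ ⟹ ℤ/ℓ ⊂ (E₀/μ_ℓ)(ℚ) ⟹ ℓ ≤ 7` by Mazur; not new) through the law and
the Literature fact `mazur_torsion`, for lack of a tree fact «`Σ(N)` is of multiplicative type».
Census (HOME/an/g27/mu3pos-rows.tsv 0a006ff66c538492 + HOME/an/g26/iota3-ALL.tsv): the 8 classes with `ι₃ = 1`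
(`14a1 19a1 26a1 35a1 77b1 370c1 27a1 54a1`) all have `3 ∣ #E₀(ℚ)_tors` and rank `0`; every decided class without
rational 3-torsion has `ι₃ = 0` (30/58 residue survivors by ENGINE 2, j312822/j313134; 396c1 structurally).
PARTITION 0.  BSD is not proved by this; Manin's conjecture is not proved by this.
-/

noncomputable section

open scoped Classical MatrixGroups ModularForm ComplexConjugate

open CongruenceSubgroup Complex WeierstrassCurve UpperHalfPlane Literature.NumberTheory.EllipticCurves
  Literature.NumberTheory.EllipticCurves.ModularForms

namespace Summit.BirchSwinnertonDyer.Rank1Residual.ManinAdditive.KatoCurve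

open Summit.BirchSwinnertonDyer.Rank1Residual.ManinAdditive.KatoCurve
  Summit.BirchSwinnertonDyer.Rank1Residual.ManinAdditive.CuspidalKummer
  Summit.BirchSwinnertonDyer.Rank1Residual.ManinAdditive.CuspidalKummerThree

/-! ### §1. The cusp-lifting law (E-an-128) and its f-shadow (E-an-128♮) -/

/-- **E-an-128 `ShimuraThreeForcesRationalThreeTorsion`** (THEOREM on paper, MEMO-an §69.2; typed as a law):
for lattice-optimal `W` (`Λ_W = c·Λ₀(f)`), `3 ∣ [Λ₀(f) : Λ₁(f)]` forces a rational point of order `3` on `W`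
(on the short model `E_{W,c}`, es/an g14 coordinates).  Why it might fail: only through the analytic dictionary
`ℂ/Λ₁(f) = E₁(ℂ)`, `ker(E₁ → E₀) = (E₀ ∩ Σ(N))ᴰ` (Ling–Oesterlé 1991 Thm; Vatsal 2005 Rem. 1.8) — the torsor
argument itself is unconditional.  Sources: Vatsal2005 (doi:10.1017/S147474800500006X) Thm 1.17/Rem 1.18;
Mazur1977 §II.11; LingOesterle1991; census above.
TYPER FRAMING: lens an; THEOREM on paper (MEMO-an §69.2), typed as a LAW; BC5 = the `ι₃` census of the module docstring (8/8
`ι₃ = 1` classes carry rational `3`-torsion; 30/58 survivors decided `ι₃ = 0`); REF1 R-an-49 / REF2 R-an-50 PENDING at filing.  OPEN in Lean.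
[cite: Vatsal2005, Thm. 1.17, Rem. 1.18 (shape only: the Shimura subcover and the constant kernel of `E₁ → E₀`; the cusp-lifting law «`3 ∣ [Λ₀:Λ₁]` ⟹ rational 3-torsion on the optimal curve» is the cell's E-an-128 — an MEMO-an §69, NOT in print as stated)] -/
@[conjecture]
def ShimuraThreeForcesRationalThreeTorsion : Prop :=
  ∀ (W : WeierstrassCurve ℚ) [W.IsElliptic] [W.IsGloballyMinimal] {N : ℕ} [NeZero N]
    (D : ModularParametrizationData W N),
    (∀ z ∈ D.L.lattice, ∃ w ∈ periodLattice D.f, z = D.c * w) →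
    ¬ ShimuraIndexPrimeTo 3 D.f → ∃ X₀ Y₀ : ℚ, IsShortThreeTorsion W D.c X₀ Y₀

/-- **E-an-128ℓ `ShimuraOddPrimeForcesRationalTorsion`** (THEOREM on paper, same proof for every odd prime `ℓ`):
`ℓ ∣ [Λ₀(f) : Λ₁(f)]` forces a rational point of order `ℓ` on the lattice-optimal curve `W`.
TYPER FRAMING: as E-an-128 (same source a3f085befa32e0ff, same proof for every odd `ℓ`); with `mazur_torsion` it gives E-an-129 (§3,
PROVED edge).  REF1 R-an-49 / REF2 R-an-50 PENDING.  OPEN in Lean.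
[cite: Vatsal2005, Thm. 1.17, Rem. 1.18 (shape only; the law is the cell's E-an-128ℓ — an MEMO-an §69.2)] -/
@[conjecture]
def ShimuraOddPrimeForcesRationalTorsion : Prop :=
  ∀ (W : WeierstrassCurve ℚ) [W.IsElliptic] [W.IsGloballyMinimal] {N : ℕ} [NeZero N]
    (D : ModularParametrizationData W N) (ℓ : ℕ), ℓ.Prime → ℓ ≠ 2 →
    (∀ z ∈ D.L.lattice, ∃ w ∈ periodLattice D.f, z = D.c * w) →
    ¬ ShimuraIndexPrimeTo ℓ D.f → ∃ Q : W.toAffine.Point, addOrderOf Q = ℓ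

/-- **E-an-128♮ `ShimuraOddPrimeForcesCuspZeroOrder`** (THEOREM on paper; the pure `f`-shadow, no optimality
binder): if `ℓ ∣ [Λ₀(f) : Λ₁(f)]` for the newform `f` of an elliptic curve, the class of the cusp-zero period
`{∞, 0}_f` in `ℂ/Λ₀(f) = E₀(ℂ)` — the cuspidal point `φ((0) − (∞))` — has order divisible by `ℓ`:
no multiple `m·{∞,0}_f` with `ℓ ∤ m` lies in `Λ₀(f)`.
TYPER FRAMING: the optimality-free `f`-shadow of E-an-128ℓ (same source); implied by E-an-128♭ (§4, PROVED edge
`shimuraOddPrimeForcesCuspZeroOrder_of_primePower`).  REF1 R-an-49 PENDING.  OPEN in Lean.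
[cite: Vatsal2005, Rem. 1.18 (shape only; the law is the cell's E-an-128♮ — an MEMO-an §69.2)] -/
@[conjecture]
def ShimuraOddPrimeForcesCuspZeroOrder : Prop :=
  ∀ (W : WeierstrassCurve ℚ) [W.IsElliptic] {N : ℕ} [NeZero N] (D : ModularParametrizationData W N) (ℓ : ℕ),
    ℓ.Prime → ℓ ≠ 2 → ¬ ShimuraIndexPrimeTo ℓ D.f →
    ∀ m : ℕ, ¬ ℓ ∣ m → (m : ℂ) * modularSymbol D.f 0 ∉ periodLattice D.f

/-- PROVED shadow: `ℓ ∣ [Λ₀ : Λ₁] ⟹ L(f, 1) = {∞, 0}_f ≠ 0` (analytic rank `0`; census: all 8 `ι₃ = 1` classes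
have rank `0`). -/
theorem modularSymbol_zero_ne_zero_of_not_shimuraIndexPrimeTo (h : ShimuraOddPrimeForcesCuspZeroOrder)
    (W : WeierstrassCurve ℚ) [W.IsElliptic] {N : ℕ} [NeZero N] (D : ModularParametrizationData W N) {ℓ : ℕ}
    (hℓ : ℓ.Prime) (hℓ2 : ℓ ≠ 2) (hS : ¬ ShimuraIndexPrimeTo ℓ D.f) : modularSymbol D.f 0 ≠ 0 := by
  intro h0
  have h1 := h W D ℓ hℓ hℓ2 hS 1 (by
    intro hd
    have := Nat.le_of_dvd Nat.one_pos hd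
    exact absurd (hℓ.two_le.trans this) (by norm_num))
  apply h1
  rw [h0, mul_zero]
  exact (periodLattice D.f).zero_mem

/-! ### §2. PROVED edges: E-an-128 ⟹ E-es-67♯₂₇, E-es-67♯, E-es-67 (all levels, no sign law) -/

/-- E-an-128 ⟹ the 27-adic residual law E-es-67♯₂₇ (the `μ₃` and `27 ∣ N` binders are not even used). -/
theorem plusIndexPrimeToThreeOfMuThreeAt27_of_cuspLifting (h : ShimuraThreeForcesRationalThreeTorsion) :
    PlusIndexPrimeToThreeOfMuThreeAt27 := by
  intro W _ _ N _ D hopt _h27 _hμ hT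
  refine plusIndexPrimeTo_of_shimuraIndexPrimeTo Nat.prime_three D.f ?_
  by_contra hS
  obtain ⟨X₀, Y₀, hXY⟩ := h W D hopt hS
  exact hT X₀ Y₀ hXY

/-- E-an-128 ⟹ E-es-67♯ (`9 ∣ N`, `μ₃ ⊆ W`, no rational 3-torsion ⟹ plus index prime to 3). -/
theorem plusIndexPrimeToThreeOfMuThreeNoRationalThreeTorsion_of_cuspLifting
    (h : ShimuraThreeForcesRationalThreeTorsion) : PlusIndexPrimeToThreeOfMuThreeNoRationalThreeTorsion := by
  intro W _ _ N _ D hopt _h9 _hμ hT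
  refine plusIndexPrimeTo_of_shimuraIndexPrimeTo Nat.prime_three D.f ?_
  by_contra hS
  obtain ⟨X₀, Y₀, hXY⟩ := h W D hopt hS
  exact hT X₀ Y₀ hXY

/-- E-an-128 ⟹ the whole of E-es-67 (`9 ∣ N`, no rational 3-torsion ⟹ plus index prime to 3), WITHOUT
E-es-67♮ and without `9 ∣ N`. -/
theorem plusIndexPrimeToThreeOfNoRationalThreeTorsion_of_cuspLifting (h : ShimuraThreeForcesRationalThreeTorsion) :
    PlusIndexPrimeToThreeOfNoRationalThreeTorsion := by
  intro W _ _ N _ D hopt _h9 hT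
  refine plusIndexPrimeTo_of_shimuraIndexPrimeTo Nat.prime_three D.f ?_
  by_contra hS
  obtain ⟨X₀, Y₀, hXY⟩ := h W D hopt hS
  exact hT X₀ Y₀ hXY

/-- Hence E-es-61 (`ThreeAdicUnitWitnessOfNoRationalThreeTorsion`, the C3-side input `h61`) from E-es-66 and
E-an-128 alone (PROVED composition with the tree's `threeAdicUnitWitnessOfNoRationalThreeTorsion_of_plusIndex`). -/
theorem threeAdicUnitWitnessOfNoRationalThreeTorsion_of_cuspLifting
    (h66 : ThreeAdicWitnessOfPlusIndexPrimeToThree) (h : ShimuraThreeForcesRationalThreeTorsion) :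
    ThreeAdicUnitWitnessOfNoRationalThreeTorsion :=
  threeAdicUnitWitnessOfNoRationalThreeTorsion_of_plusIndex h66
    (plusIndexPrimeToThreeOfNoRationalThreeTorsion_of_cuspLifting h)

/-! ### §3. PROVED edge: with Mazur's torsion theorem the odd Shimura index is supported on `{3, 5, 7}` (E-an-129) -/

/-- **E-an-129** (PROVED from E-an-128ℓ and Mazur's theorem `mazur_torsion`, a Literature fact used BY NAME; mathematically
elementary — `μ_ℓ ⊂ E₀` alone forces `ℓ ≤ 7` — and recorded only as a by-name edge):
for a lattice-optimal elliptic `W` and every prime `ℓ ≥ 11`, `ℓ ∤ [Λ₀(f) : Λ₁(f)]`. -/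
theorem shimuraIndexPrimeTo_of_eleven_le (h : ShimuraOddPrimeForcesRationalTorsion)
    (hMT : ∀ V : WeierstrassCurve ℚ, mazur_torsion V)
    (W : WeierstrassCurve ℚ) [W.IsElliptic] [W.IsGloballyMinimal] {N : ℕ} [NeZero N]
    (D : ModularParametrizationData W N) (hopt : ∀ z ∈ D.L.lattice, ∃ w ∈ periodLattice D.f, z = D.c * w)
    {ℓ : ℕ} (hℓ : ℓ.Prime) (h11 : 11 ≤ ℓ) : ShimuraIndexPrimeTo ℓ D.f := by
  by_contra hS
  have hℓ2 : ℓ ≠ 2 := by omega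
  exact not_exists_addOrderOf_eq_of_mazur_torsion W (hMT W) hℓ h11 (h W D ℓ hℓ hℓ2 hopt hS)

/-- Hence the plus index is prime to every `ℓ ≥ 11` as well (PROVED). -/
theorem plusIndexPrimeTo_of_eleven_le (h : ShimuraOddPrimeForcesRationalTorsion)
    (hMT : ∀ V : WeierstrassCurve ℚ, mazur_torsion V)
    (W : WeierstrassCurve ℚ) [W.IsElliptic] [W.IsGloballyMinimal] {N : ℕ} [NeZero N]
    (D : ModularParametrizationData W N) (hopt : ∀ z ∈ D.L.lattice, ∃ w ∈ periodLattice D.f, z = D.c * w)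
    {ℓ : ℕ} (hℓ : ℓ.Prime) (h11 : 11 ≤ ℓ) : PlusIndexPrimeTo ℓ D.f :=
  plusIndexPrimeTo_of_shimuraIndexPrimeTo hℓ D.f (shimuraIndexPrimeTo_of_eleven_le h hMT W D hopt hℓ h11)

/-! ### §4. The prime-power / every-prime sharpening (E-an-128♭) and its 2-adic corollary (E-an-128₄)

Same proof with `C ≅ μ_{ℓ^k}` cyclic inside `E₀ ∩ Σ(N)` (any prime `ℓ`, `k ≥ 1`): the Shimura subcover `X^ψ`,
`ψ : U ↠ ℤ/ℓ^k`, has cusp class of order EXACTLY `ℓ^k` in `H¹(ℚ, ℤ/ℓ^k)` over the inert rational cusp and `0` over the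
split one, so `δ_λ(φ(0))` has order `ℓ^k`, `ℓ^{k-1}·φ(0) ∉ λ(E'(ℚ)) ⊇ ℓ^k E₀(ℚ)`, whence `ℓ^k ∣ ord φ(0)`.  Consequently
`exp((Λ₀/Λ₁)) ∣ ord φ(0) ∣ #E₀(ℚ)_tors` and, for the (cyclic) odd part, `[Λ₀(f) : Λ₁(f)]_{odd} ∣ ord φ(0)`.
Sanity check (HOME/an/g27/u_exp_check.py, the twelve genus-one levels where `E₀ = J₀(N)`, `E₀ ∩ Σ = Σ(N) = Hom(U(N), μ)`,
`c₀ = 1` known): `exp U(N) ∣ ord φ(0)` at 12/12 (`N = 15, 17`: `4 ∣ 4`, the `ℓ = 2, k = 2` case). -/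

/-- **E-an-128♭ `ShimuraPrimePowerDividesCuspZeroOrder`** (THEOREM on paper, MEMO-an §69.2′; pure `f`-form, every prime):
if `Λ₀(f)/Λ₁(f)` has an element of order `ℓ^k` (`k ≥ 1`), then `m·{∞,0}_f ∉ Λ₀(f)` unless `ℓ^k ∣ m`.
TYPER FRAMING (§4, NEW in v2 a3f085befa32e0ff, an 18:05:09Z): every prime `ℓ`, incl. `ℓ = 2`; sanity `exp U(N) ∣ ord φ(0)` at 12/12
genus-one levels (HOME/an/g27/u_exp_check.py); REF1 R-an-49 (scope += §4) PENDING.  OPEN in Lean.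
[cite: Vatsal2005, Thm. 1.17 (shape only; the prime-power cusp-order law is the cell's E-an-128♭ — an MEMO-an §69.2′)] -/
@[conjecture]
def ShimuraPrimePowerDividesCuspZeroOrder : Prop :=
  ∀ (W : WeierstrassCurve ℚ) [W.IsElliptic] {N : ℕ} [NeZero N] (D : ModularParametrizationData W N) (ℓ k : ℕ),
    ℓ.Prime → 1 ≤ k →
    (∃ x ∈ periodLattice D.f, ((ℓ ^ k : ℕ) : ℂ) * x ∈ periodLatticeGamma1 D.f ∧
        ((ℓ ^ (k - 1) : ℕ) : ℂ) * x ∉ periodLatticeGamma1 D.f) →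
    ∀ m : ℕ, ¬ ℓ ^ k ∣ m → (m : ℂ) * modularSymbol D.f 0 ∉ periodLattice D.f

/-- PROVED edge: E-an-128♭ ⟹ E-an-128♮ (take `k = 1`). -/
theorem shimuraOddPrimeForcesCuspZeroOrder_of_primePower (h : ShimuraPrimePowerDividesCuspZeroOrder) :
    ShimuraOddPrimeForcesCuspZeroOrder := by
  intro W _ N _ D ℓ hℓ _hℓ2 hS m hm
  have hS' : ∃ x ∈ periodLattice D.f, ((ℓ ^ 1 : ℕ) : ℂ) * x ∈ periodLatticeGamma1 D.f ∧
      ((ℓ ^ (1 - 1) : ℕ) : ℂ) * x ∉ periodLatticeGamma1 D.f := by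
    by_contra hcon
    apply hS
    intro x hx hℓx
    by_contra hx1
    exact hcon ⟨x, hx, by simpa using hℓx, by simpa using hx1⟩
  exact h W D ℓ 1 hℓ le_rfl hS' m (by simpa using hm)

/-- **E-an-128₄ `ShimuraFourForcesRationalFourTorsion`** (THEOREM on paper, the `ℓ = 2, k = 2` instance made explicit for
the `4 ∣ N` lanes): if `Λ₀(f)/Λ₁(f)` has an element of order `4`, the lattice-optimal curve `W` has a rational point of
order `4` (indeed `4 ∣ ord φ(0)`).  (`k = 1` at `ℓ = 2` only says `ord φ(0)` is even.)
TYPER FRAMING (§4, NEW in v2): the first non-void 2-adic instance, offered to the `4 ∣ N` lanes (C2 stmt-BirchSwinnertonDyer-22967: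
2-sources of `U(N)` are `q ∥ N` with `q ≡ 1 (4)` or `32 ∣ N`); BC5: `N = 15, 17` (`4 ∣ 4`) in the genus-one sanity table;
REF1 R-an-49 PENDING.  OPEN in Lean.
[cite: Vatsal2005, Thm. 1.17 (shape only; the law is the cell's E-an-128₄ — an MEMO-an §69.2′)] -/
@[conjecture]
def ShimuraFourForcesRationalFourTorsion : Prop :=
  ∀ (W : WeierstrassCurve ℚ) [W.IsElliptic] [W.IsGloballyMinimal] {N : ℕ} [NeZero N]
    (D : ModularParametrizationData W N),
    (∀ z ∈ D.L.lattice, ∃ w ∈ periodLattice D.f, z = D.c * w) →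
    (∃ x ∈ periodLattice D.f, (4 : ℂ) * x ∈ periodLatticeGamma1 D.f ∧ (2 : ℂ) * x ∉ periodLatticeGamma1 D.f) →
    ∃ Q : W.toAffine.Point, addOrderOf Q = 4

/-! ### §5. The 2-adic index law (E-an-128₂) and the `p = 2` twin of the E-es-61 composition

At `ℓ = 2`, `k = 1` the torsor argument says `ord φ(0)` is even; for the INDEX LAW only the elementary half is needed:
`(E₀ ∩ Σ(N))[2] ⊂ E₀[2]` is of multiplicative type, and `μ₂ = ℤ/2`, so `2 ∣ [Λ₀(f) : Λ₁(f)]` forces a rational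
`2`-torsion point on `E₀ ≅ W` (THEOREM on paper, elementary given the dictionary of §69.1 — typed as a law for lack of
the tree fact «`Σ(N)` is of multiplicative type»).  Contrapositive + tree `plusIndexPrimeTo_of_shimuraIndexPrimeTo`:
no rational `2`-torsion ⟹ `PlusIndexPrimeTo 2 D.f`, whence with es's `2`-adic twin law E-es-66₂
`TwoAdicWitnessOfPlusIndexOdd` the `TwoAdicPolarWitness`, and with the tree's law-free stub
`not_two_dvd_maninConstant_of_noPlusDefect_stub` (C2 side): `2 ∤ c` for lattice-optimal `W`, `4 ∣ N`, no rational
`2`-torsion, no cuspidal plus defect at `2` — modulo E-es-66₂, E-an-128₂ and the named Kato facts. -/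

/-- **E-an-128₂ `ShimuraTwoForcesRationalTwoTorsion`** (THEOREM on paper, elementary: `μ₂ = ℤ/2`; law only because
«`Σ(N)` is μ-type» is not a tree fact): `2 ∣ [Λ₀(f) : Λ₁(f)]` forces a rational root of the `2`-division polynomial of
the lattice-optimal curve `W`.
TYPER FRAMING (§5, NEW in v3 sha16 497c462f3c7fcc1b, an g27 2026-08-28T18:10:22Z; appended by the cell typer g14): lens an;
elementary on paper given the Ling–Oesterlé/Vatsal dictionary; consumer = es's 2-adic twin law E-es-66₂
`TwoAdicWitnessOfPlusIndexOdd` (census 86/86) via the PROVED edges below; the C2-side TURNKEY-an-15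
`not_two_dvd_maninConstant_of_noRationalTwoTorsion` (composition with the tree stub
`Theorems.ManinLocalTwoThree.not_two_dvd_maninConstant_of_noPlusDefect_stub`) is NOT in this leaf — that stub file is inside
the theses cone (`lint.theses-cone`), so the composition is handed to the C2 LEAD as Theorems-side text
(HOME/typer/ManinLocalTwoThreeNoRationalTwoTorsion.handover.lean).  REF1 R-an-49 (+= §5) PENDING.  OPEN in Lean.
[cite: Vatsal2005, Rem. 1.18 (shape only: `ker(E₁ → E₀)` is Cartier dual to `E₀ ∩ Σ(N)`; the 2-adic index law is the cell's E-an-128₂ — an MEMO-an §69.2‴)] -/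
@[conjecture]
def ShimuraTwoForcesRationalTwoTorsion : Prop :=
  ∀ (W : WeierstrassCurve ℚ) [W.IsElliptic] [W.IsGloballyMinimal] {N : ℕ} [NeZero N]
    (D : ModularParametrizationData W N),
    (∀ z ∈ D.L.lattice, ∃ w ∈ periodLattice D.f, z = D.c * w) →
    ¬ ShimuraIndexPrimeTo 2 D.f → ∃ e : ℚ, W.twoTorsionPolynomial.toPoly.IsRoot e

/-- PROVED edge (the `2`-adic index law): no rational `2`-torsion ⟹ `PlusIndexPrimeTo 2 D.f`, modulo E-an-128₂. -/
theorem plusIndexPrimeTo_two_of_noRationalTwoTorsion (h : ShimuraTwoForcesRationalTwoTorsion)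
    (W : WeierstrassCurve ℚ) [W.IsElliptic] [W.IsGloballyMinimal] {N : ℕ} [NeZero N]
    (D : ModularParametrizationData W N) (hopt : ∀ z ∈ D.L.lattice, ∃ w ∈ periodLattice D.f, z = D.c * w)
    (hT : ∀ e : ℚ, ¬ W.twoTorsionPolynomial.toPoly.IsRoot e) : PlusIndexPrimeTo 2 D.f := by
  refine plusIndexPrimeTo_of_shimuraIndexPrimeTo Nat.prime_two D.f ?_
  by_contra hS
  obtain ⟨e, he⟩ := h W D hopt hS
  exact hT e he

/-- PROVED composition (`p = 2` twin of `threeAdicUnitWitnessOfNoRationalThreeTorsion_of_cuspLifting`):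
E-es-66₂ ∘ E-an-128₂ give the `2`-adic polar witness for lattice-optimal `W` with `4 ∣ N` and no rational `2`-torsion. -/
theorem twoAdicPolarWitness_of_noRationalTwoTorsion (h66 : TwoAdicWitnessOfPlusIndexOdd)
    (h : ShimuraTwoForcesRationalTwoTorsion)
    (W : WeierstrassCurve ℚ) [W.IsElliptic] [W.IsGloballyMinimal] {N : ℕ} [NeZero N]
    (D : ModularParametrizationData W N) (hopt : ∀ z ∈ D.L.lattice, ∃ w ∈ periodLattice D.f, z = D.c * w)
    (h4 : 2 ^ 2 ∣ N) (hT : ∀ e : ℚ, ¬ W.twoTorsionPolynomial.toPoly.IsRoot e) : TwoAdicPolarWitness W W D.f :=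
  h66 W D hopt h4 (plusIndexPrimeTo_two_of_noRationalTwoTorsion h W D hopt hT)

end Summit.BirchSwinnertonDyer.Rank1Residual.ManinAdditive.KatoCurve
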